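import Summits.BirchSwinnertonDyer.Rank1Residual.Additive.CyclotomicTowerSignedLocalTransverse
import HarnessLib

/-!
# Kobayashi's Prop. 8.12 ii), FIRST identity, PROVED: `E⁺(K_{n,v}) ∩ E⁻(K_{n,v}) = E(K_{−1,v})` from
# "no `p`-torsion" alone — and the transversality of the η-odd Kummer line to the minus condition with
# that hypothesis DISCHARGED (cell `b2b-bsdres`, CLASS-CLOSURE lane, class O10 — x1b GEN 31, class lead;
# sequel of `CyclotomicTowerSignedLocalTransverse.lean`, p312958)

HONEST FRAMING (cell `b2b-bsdres`, run/shared/lean/b2b/bsd-rank1-residual/, verbatim in every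
file): the goal of the cell is to DELETE the COMBINATION-SHAPED residual classes of the
Birch–Swinnerton-Dyer formula for ALL analytic-rank `≤ 1` elliptic curves over `ℚ` — "full BSD
formula for every rank `≤ 1` curve in class `C`" assembled STRICTLY from published theorems — so
that the rank-`≤ 1` remainder becomes exactly the CONSTRUCTION-SHAPED classes, which are TYPED
(missing-input `Prop`s), NOT attempted. This is not "finishing BSD". CLASS-CLOSURE lane: prove
what is provable now; shrink each hard class to its core with data; no claim beyond stated classes;
research routes on CONSTRUCTION-SHAPED X12 / O10; census / instrument output = EVIDENCE / conjecture
items, NEVER a Literature fact; `RESIDUAL-MAP.md` marks change only by signed lines. THIS FILE: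
TOOL THEOREMS ONLY over cc-typer-6's vocabulary (`towerSignedLocalPointsOfEmb`,
`localFixedPointsOfEmb`, `localPairTraceOfEmb`) — no definition, no named Literature fact, no
Summits-side fact `def`, no `sorry`, axioms standard; nothing is booked; no label / mark / count /
sub-cell moves; O10 stays OPEN / CONSTRUCTION-SHAPED; nothing about `BSD(W, p)` of any pair is claimed.

## Source, verbatim (S. Kobayashi, Invent. Math. 152 (2003) [Kobayashi2003], held copy
`paper:doi-10-1007-s00222-002-0265-4`, p. 18, proof of Prop. 8.12 — page-read by x1b GEN 31)

"Proof. We first show that `C_ss(m_n) ∩ C_ss(m_{n−1}) = F_ss(m_{−1})`. Let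
`P ∈ C_ss(m_n) ∩ C_ss(m_{n−1})`. We show that if `P ∈ F_ss(m_m)` then `P ∈ F_ss(m_{m−1})`. Suppose
that `n ≡ m − 1 mod 2`. Then by the definition of `C_ss(m_n)`, we have
`p^{n−m} P = Tr^{ss}_{n/m} P ∈ F_ss(m_{m−1})`. Therefore for `σ ∈ Gal(k_m/k_{m−1})`, we have
`p^{n−m}(P^σ − P) = 0`. Hence, by Proposition 8.7, `P ∈ F_ss(m_{m−1})`. The case `n ≡ m mod 2` is
shown similarly by considering `n − 1` instead of `n` in the above argument."

With Def. 8.16 (p. 19: `{Ê⁺(m_n), Ê⁻(m_n)} = {C_Ê(m_n), C_Ê(m_{n−1})}`) this is the identity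
**`Ê⁺(m_n) ∩ Ê⁻(m_n) = Ê(m_{−1})`**. In the tree's transcription (`towerSignedLocalPointsOfEmb`, §2
p. 4 verbatim, `K_{−1}` = the subgroup `⊤`) the SAME four lines prove it for the full-point groups:
for `P ∈ E⁺(K_{n,v}) ∩ E⁻(K_{n,v})` and `P ∈ E(K_{m,v})`, `m ≥ 0`, the condition of index `m − 1`
(plus side if `m − 1` is even, minus side — including the `m − 1 = −1` clause — if odd) reads
`Tr_{n/m} P = [K_{n,v} : K_{m,v}]·P ∈ E(K_{m−1,v})` (`localPairTraceOfEmb_apply_of_mem_lower`), and a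
`[K_{n,v}:K_{m,v}]`-th root inside `E(K_{n,v})` of a `K_{m−1,v}`-point is `K_{m−1,v}`-rational when
`E(K_{n,v})` has no torsion of that order (`mem_localFixedPointsOfEmb_of_nsmul_mem`, p312958). The ONLY
inputs are therefore: no `q`-torsion in `E(K_{n,v})` (Prop. 8.7, hypothesis `htors`) and the layer
indices `[K_{n,v} : K_{m,v}]` dividing a power of `q` (hypothesis `hidx`; for Kobayashi's tower
`[k_n : k_m] = p^{n−m}`; in FILE 2's instance it follows from `Subgroup.index_comap` +
`ZpExtension.index_layerSubgroup`). The SECOND identity `Ê(m_n) = Ê⁺(m_n) + Ê⁻(m_n)` (generation by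
Kobayashi's points `c_n`, Prop. 8.11) is NOT proved here and stays the hypothesis `hsum`.

## What is proved

* §1 `noTorsion_pow`, `noTorsion_of_dvd_pow`: no `q`-torsion ⟹ no `q^k`- / no `d`-torsion for `d ∣ q^k`.
* §2 **`inf_towerSignedLocalPointsOfEmb_le_top`** (Prop. 8.12 ii), first identity, `⊆`):
  `E⁺(K_{n,v}) ⊓ E⁻(K_{n,v}) ≤ E(K_{−1,v})`; with the tree's
  `localFixedPointsOfEmb_top_le_towerSignedLocalPointsOfEmb` (`⊇`):
  **`inf_towerSignedLocalPointsOfEmb_eq_top`** — `E⁺(K_{n,v}) ⊓ E⁻(K_{n,v}) = E(K_{−1,v})`.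
* §3 TRANSVERSALITY with `hint` DISCHARGED (`exists_mem_zero_eq_nsmul_of_eq_add_nsmul'`,
  `exists_mem_zero_eq_nsmul_of_pow_nsmul_eq_add'`): an η-odd bottom point `P ∈ E(K_{0,v})`
  (`τ • P = −P`) with `q^j • P ∈ E⁻(K_{n,v}) + q^{j+1}·E(K_{n,v})` is `q`-divisible in `E(K_{0,v})`,
  now under `hsum` (Prop. 8.12 ii) second identity), `htors` (Prop. 8.7), `hidx`, `q` odd ONLY. Reading
  (x1b GEN 31 note `class-closure/O10/C3ETA-TRANSVERSALITY-x1b.md`): the η-twisted Kummer line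
  `W(ℚ_p) ⊗ ℚ_p/ℤ_p` meets the η-part of Kobayashi's minus condition trivially (`u(p) = 0`), the local
  heart of the (C3_η) derivation; the remaining printed input on the local side is the generation
  statement `hsum` alone.

References: [Kobayashi2003] §2 p. 4, Prop. 8.7 (p. 16), Prop. 8.12 + proof (pp. 17–18), Def. 8.16
(p. 19); [SerreGaloisCohomology1997] II.§1.1.
-/

noncomputable section

open scoped Classical

universe u

namespace Summit.BirchSwinnertonDyer.Rank1Residual.Additive

open Literature.NumberTheory.EllipticCurves Literature.NumberTheory.GaloisRepresentations
  Literature.NumberTheory.EllipticCurves.Kobayashi2003 ZpExtension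

/-! ## §1 Torsion bookkeeping -/

section Torsion

variable {A : Type*} [AddCommGroup A] (S : AddSubgroup A)

/-- No `q`-torsion in `S` ⟹ no `q^k`-torsion in `S`. [folklore] -/
theorem noTorsion_pow {q : ℕ} (htors : ∀ Q ∈ S, q • Q = 0 → Q = 0) (k : ℕ) :
    ∀ Q ∈ S, q ^ k • Q = 0 → Q = 0 := by
  induction k with
  | zero => intro Q _ h; simpa using h
  | succ k ih =>
    intro Q hQ h
    rw [pow_succ, mul_nsmul'] at h
    exact htors Q hQ (ih (q • Q) (S.nsmul_mem hQ q) h)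

/-- No `q`-torsion in `S` ⟹ no `d`-torsion in `S` for every `d` dividing a power of `q`. [folklore] -/
theorem noTorsion_of_dvd_pow {q d k : ℕ} (htors : ∀ Q ∈ S, q • Q = 0 → Q = 0) (hd : d ∣ q ^ k) :
    ∀ Q ∈ S, d • Q = 0 → Q = 0 := by
  intro Q hQ h
  obtain ⟨e, he⟩ := hd
  refine noTorsion_pow S htors k Q hQ ?_
  rw [he, mul_nsmul, h, smul_zero]

end Torsion

/-! ## §2 Prop. 8.12 ii), first identity: `E⁺(K_{n,v}) ∩ E⁻(K_{n,v}) = E(K_{−1,v})` -/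

section Intersection

variable {K : Type u} [Field K] {E : Type u} [Field E] [Algebra K E]
  (U : ℕ → Subgroup (Field.absoluteGaloisGroup K)) [hU : ∀ n, (U n).FiniteIndex]
  (ι : AlgebraicClosure K →ₐ[K] AlgebraicClosure E) (W : WeierstrassCurve K)

/-- **Kobayashi's Prop. 8.12 ii), first identity (`⊆`), PROVED from no-torsion**: for a tower of
normal finite-index subgroups whose local layer indices `[K_{n,v} : K_{m,v}]` divide powers of `q`
(antitone is NOT needed here), and `E(K_{n,v})` without `q`-torsion (Prop. 8.7),
**`E⁺(K_{n,v}) ⊓ E⁻(K_{n,v}) ≤ E(K_{−1,v})`**.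
Proof = p. 18 verbatim: if `P ∈ E(K_{m,v})` (`m ≥ 1`) then the signed condition of index `m − 1`
(plus if even, minus if odd) gives `[K_{n,v}:K_{m,v}]·P = Tr_{n/m} P ∈ E(K_{m−1,v})`, so `P` is
`K_{m−1,v}`-rational (no torsion of that order); descend from `m = n` to `m = 0`, then the `m = −1`
clause gives `[K_{n,v}:K_{0,v}]·P ∈ E(K_{−1,v})` and `P ∈ E(K_{−1,v})`.
[cite: Kobayashi2003, Prop. 8.12 ii) + proof (pp. 17–18), Def. 8.16 (p. 19), Prop. 8.7 (p. 16)] -/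
theorem inf_towerSignedLocalPointsOfEmb_le_top [hN : ∀ n, (U n).Normal] (n : ℕ)
    {q : ℕ} (htors : ∀ Q ∈ localFixedPointsOfEmb ι W (U n), q • Q = 0 → Q = 0)
    (hidx : ∀ m ≤ n, ∃ k : ℕ, ((localSubgroupOfEmb (U n) ι).subgroupOf (localSubgroupOfEmb (U m) ι)).index ∣ q ^ k) :
    towerSignedLocalPointsOfEmb U ι W 1 n ⊓ towerSignedLocalPointsOfEmb U ι W (-1) n ≤
      localFixedPointsOfEmb ι W ⊤ := by
  intro P hP
  obtain ⟨hPp, hPm⟩ := AddSubgroup.mem_inf.mp hP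
  have hPn : P ∈ localFixedPointsOfEmb ι W (U n) := hPp.1
  rw [mem_towerSignedLocalPointsOfEmb_one_iff] at hPp
  rw [mem_towerSignedLocalPointsOfEmb_neg_one_iff] at hPm
  -- no torsion of order any layer index
  have htorsIdx : ∀ m ≤ n, ∀ Q ∈ localFixedPointsOfEmb ι W (U n),
      ((localSubgroupOfEmb (U n) ι).subgroupOf (localSubgroupOfEmb (U m) ι)).index • Q = 0 → Q = 0 := by
    intro m hm
    obtain ⟨k, hk⟩ := hidx m hm
    exact noTorsion_of_dvd_pow _ htors hk
  -- descent: `P ∈ E(K_{n-k,v})` for all `k ≤ n`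
  have key : ∀ k, k ≤ n → P ∈ localFixedPointsOfEmb ι W (U (n - k)) := by
    intro k
    induction k with
    | zero => intro _; simpa using hPn
    | succ k ih =>
      intro hk
      have hm : P ∈ localFixedPointsOfEmb ι W (U (n - (k + 1) + 1)) := by
        rw [show n - (k + 1) + 1 = n - k by omega]; exact ih (by omega)
      -- the signed condition of index `m' = n - (k+1) < n`, on the side of its parity
      have htr : localPairTraceOfEmb ι W (U (n - (k + 1) + 1)) (U n) P ∈
          localFixedPointsOfEmb ι W (U (n - (k + 1))) := by
        rcases Nat.even_or_odd (n - (k + 1)) with he | ho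
        · exact hPp.2 _ (by omega) he
        · exact hPm.2.1 _ (by omega) ho
      rw [localPairTraceOfEmb_apply_of_mem_lower ι W hm] at htr
      exact mem_localFixedPointsOfEmb_of_nsmul_mem ι W (htorsIdx _ (by omega)) hPn htr
  -- bottom: `P ∈ E(K_{0,v})`, then the `m = -1` clause
  have h0 : P ∈ localFixedPointsOfEmb ι W (U 0) := by simpa using key n le_rfl
  have htr := hPm.2.2
  rw [localPairTraceOfEmb_apply_of_mem_lower ι W h0] at htr
  exact mem_localFixedPointsOfEmb_of_nsmul_mem ι W (htorsIdx 0 n.zero_le) hPn htr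

/-- **`E⁺(K_{n,v}) ∩ E⁻(K_{n,v}) = E(K_{−1,v})`** (Prop. 8.12 ii), first identity, as an EQUALITY):
`⊆` by `inf_towerSignedLocalPointsOfEmb_le_top`, `⊇` by the tree's
`localFixedPointsOfEmb_top_le_towerSignedLocalPointsOfEmb` (FILE 1). [cite: Kobayashi2003, Prop. 8.12 ii) (p. 17), Def. 8.16 (p. 19)] -/
theorem inf_towerSignedLocalPointsOfEmb_eq_top [hN : ∀ n, (U n).Normal] (n : ℕ)
    {q : ℕ} (htors : ∀ Q ∈ localFixedPointsOfEmb ι W (U n), q • Q = 0 → Q = 0)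
    (hidx : ∀ m ≤ n, ∃ k : ℕ, ((localSubgroupOfEmb (U n) ι).subgroupOf (localSubgroupOfEmb (U m) ι)).index ∣ q ^ k) :
    towerSignedLocalPointsOfEmb U ι W 1 n ⊓ towerSignedLocalPointsOfEmb U ι W (-1) n =
      localFixedPointsOfEmb ι W ⊤ :=
  le_antisymm (inf_towerSignedLocalPointsOfEmb_le_top U ι W n htors hidx)
    (le_inf (localFixedPointsOfEmb_top_le_towerSignedLocalPointsOfEmb U ι W 1 n)
      (localFixedPointsOfEmb_top_le_towerSignedLocalPointsOfEmb U ι W (-1) n))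

end Intersection

/-! ## §3 Transversality with `hint` discharged -/

section Transverse

variable {K : Type u} [Field K] {E : Type u} [Field E] [Algebra K E]
  (U : ℕ → Subgroup (Field.absoluteGaloisGroup K)) [hU : ∀ n, (U n).FiniteIndex]
  (ι : AlgebraicClosure K →ₐ[K] AlgebraicClosure E) (W : WeierstrassCurve K)

/-- **TRANSVERSALITY of the η-odd bottom line to the minus condition, modulo the generation statement
`hsum` (Prop. 8.12 ii), second identity) ONLY** — the intersection hypothesis of p312958's
`exists_mem_zero_eq_nsmul_of_eq_add_nsmul` is discharged by §2: `P ∈ E(K_{0,v})`, `τ • P = −P`,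
`P = M + q • Q` with `M ∈ E⁻(K_{n,v})`, `Q ∈ E(K_{n,v})`, no `q`-torsion, layer indices `q`-power
divisors, `q` odd ⟹ `P = q • S` with `S ∈ E(K_{0,v})`.
[cite: Kobayashi2003, Prop. 8.12 ii) (pp. 17–18), Def. 8.16 (p. 19), Prop. 8.7 (p. 16)] -/
theorem exists_mem_zero_eq_nsmul_of_eq_add_nsmul' (hUa : Antitone U) [hN : ∀ n, (U n).Normal] (n : ℕ)
    (hsum : localFixedPointsOfEmb ι W (U n) ≤
      towerSignedLocalPointsOfEmb U ι W 1 n ⊔ towerSignedLocalPointsOfEmb U ι W (-1) n)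
    {q : ℕ} (hq : Odd q) (htors : ∀ Q ∈ localFixedPointsOfEmb ι W (U n), q • Q = 0 → Q = 0)
    (hidx : ∀ m ≤ n, ∃ k : ℕ, ((localSubgroupOfEmb (U n) ι).subgroupOf (localSubgroupOfEmb (U m) ι)).index ∣ q ^ k)
    {P : localPoints W E} (hP : P ∈ localFixedPointsOfEmb ι W (U 0))
    {τ : Field.absoluteGaloisGroup E} (hτ : τ • P = -P)
    {M Q : localPoints W E} (hM : M ∈ towerSignedLocalPointsOfEmb U ι W (-1) n)
    (hQ : Q ∈ localFixedPointsOfEmb ι W (U n)) (hPMQ : P = M + q • Q) :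
    ∃ S ∈ localFixedPointsOfEmb ι W (U 0), P = q • S :=
  exists_mem_zero_eq_nsmul_of_eq_add_nsmul U ι W hUa n hsum
    (inf_towerSignedLocalPointsOfEmb_le_top U ι W n htors hidx) hq htors hP hτ hM hQ hPMQ

/-- **Divisible (Kummer-level) form with `hint` discharged**: `q^j • P = M + q^{j+1} • Q` with
`M ∈ E⁻(K_{n,v})`, `Q ∈ E(K_{n,v})` ⟹ `P ∈ q·E(K_{0,v})`; so for the η-odd generator (not
`q`-divisible in `E(K_{0,v})`) NO non-zero class of its Kummer line lands in
`E⁻(K_{n,v}) ⊗ ℚ_q/ℤ_q`, at any layer — hypotheses: `hsum`, `htors`, `hidx`, `q` odd.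
[cite: Kobayashi2003, Prop. 8.12 ii) (pp. 17–18), Lemma 8.17 (p. 19), Prop. 8.7 (p. 16)] -/
theorem exists_mem_zero_eq_nsmul_of_pow_nsmul_eq_add' (hUa : Antitone U) [hN : ∀ n, (U n).Normal]
    (n : ℕ)
    (hsum : localFixedPointsOfEmb ι W (U n) ≤
      towerSignedLocalPointsOfEmb U ι W 1 n ⊔ towerSignedLocalPointsOfEmb U ι W (-1) n)
    {q : ℕ} (hq : Odd q) (htors : ∀ Q ∈ localFixedPointsOfEmb ι W (U n), q • Q = 0 → Q = 0)
    (hidx : ∀ m ≤ n, ∃ k : ℕ, ((localSubgroupOfEmb (U n) ι).subgroupOf (localSubgroupOfEmb (U m) ι)).index ∣ q ^ k)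
    {P : localPoints W E} (hP : P ∈ localFixedPointsOfEmb ι W (U 0))
    {τ : Field.absoluteGaloisGroup E} (hτ : τ • P = -P) (j : ℕ)
    {M Q : localPoints W E} (hM : M ∈ towerSignedLocalPointsOfEmb U ι W (-1) n)
    (hQ : Q ∈ localFixedPointsOfEmb ι W (U n)) (hPMQ : q ^ j • P = M + q ^ (j + 1) • Q) :
    ∃ S ∈ localFixedPointsOfEmb ι W (U 0), P = q • S :=
  exists_mem_zero_eq_nsmul_of_pow_nsmul_eq_add U ι W hUa n hsum
    (inf_towerSignedLocalPointsOfEmb_le_top U ι W n htors hidx) hq htors hP hτ j hM hQ hPMQ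

/-- Contrapositive: an η-odd bottom point NOT `q`-divisible in `E(K_{0,v})` has NO class
`q^j • P ⊗ q^{−(j+1)}` of its Kummer line in `E⁻(K_{n,v}) + q^{j+1}·E(K_{n,v})`, for any `j`, `n` —
hypotheses `hsum`, `htors`, `hidx`, `q` odd. [cite: Kobayashi2003, Prop. 8.12 ii) (pp. 17–18), Prop. 8.7 (p. 16)] -/
theorem not_exists_pow_nsmul_eq_add_of_not_nsmul (hUa : Antitone U) [hN : ∀ n, (U n).Normal] (n : ℕ)
    (hsum : localFixedPointsOfEmb ι W (U n) ≤
      towerSignedLocalPointsOfEmb U ι W 1 n ⊔ towerSignedLocalPointsOfEmb U ι W (-1) n)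
    {q : ℕ} (hq : Odd q) (htors : ∀ Q ∈ localFixedPointsOfEmb ι W (U n), q • Q = 0 → Q = 0)
    (hidx : ∀ m ≤ n, ∃ k : ℕ, ((localSubgroupOfEmb (U n) ι).subgroupOf (localSubgroupOfEmb (U m) ι)).index ∣ q ^ k)
    {P : localPoints W E} (hP : P ∈ localFixedPointsOfEmb ι W (U 0))
    {τ : Field.absoluteGaloisGroup E} (hτ : τ • P = -P)
    (hndiv : ∀ S ∈ localFixedPointsOfEmb ι W (U 0), P ≠ q • S) (j : ℕ) :
    ¬ ∃ M ∈ towerSignedLocalPointsOfEmb U ι W (-1) n, ∃ Q ∈ localFixedPointsOfEmb ι W (U n),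
      q ^ j • P = M + q ^ (j + 1) • Q := by
  rintro ⟨M, hM, Q, hQ, hPMQ⟩
  obtain ⟨S, hS, hPS⟩ :=
    exists_mem_zero_eq_nsmul_of_pow_nsmul_eq_add' U ι W hUa n hsum hq htors hidx hP hτ j hM hQ hPMQ
  exact hndiv S hS hPS

end Transverse

end Summit.BirchSwinnertonDyer.Rank1Residual.Additive

end
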